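import Literature.Probability.FitznerVanDerHofstad2017.BinomialCoincidenceMonotone
import Literature.Barriers.CriticalPhenomena.RigorousRGSmallParameterFracLaplacian

/-!
# Literature.Probability.FitznerVanDerHofstad2017.SrwLawRates — nearest-neighbour walks with general coordinate
rates, and monotonicity under a rate transfer inside a pair of coordinates

CITATION HEADER (PLACEMENT v2). Build `lace`, node N52 (i) / obligations O1a–O1b of `HOME/b2b-lace-num5-g5/RESULTS.md`
§4 (seat dmps-g13); paper proof `HOME/b2b-lace-dmps-g13/DMONO-ALLX.md` §§1–2, 4.  Second of three files
(`BinomialCoincidenceMonotone` ← this file ← `SrwLawDimMonotoneAllX`) proving that the simple-random-walk transition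
probabilities `p_N^{(d)}(x)` (`LongRangePhi4.srwLaw`, [cite: Slade2017, Lemma 2.2.1]) are non-increasing in the
dimension at EVERY endpoint: `p_N^{(d+1)}((x,0)) ≤ p_N^{(d)}(x)`; context [FvdH21 = FitznerVanDerHofstad2021LTLA, §9,
Lemma 9.2] (there only for `‖x‖_∞ ≤ 2`).

Contents.  The walk on `ℤ^D` which at each step picks coordinate `j` with probability `r j` and moves `±e_j` with
probability `1/2` each (`rwLaw r n`), realised as `(A_r)^n δ₀` for the generator `A_r = Σ_j r_j K_j`,
`K_j = (T_{e_j} + T_{-e_j})/2`, in the commutative algebra of translation operators `T_v f = f(· + v)` on all real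
functions on `ℤ^D` (`Module.End ℝ`).  (i) `rwLaw (fun _ => 1/D) = srwLaw D` (`rwLaw_uniform`).  (ii) For rates
`pairRates rest μ ν ρ γ` = (`ρ(1-γ)` on `μ`, `ργ` on `ν`, `rest` elsewhere), the binomial theorem for commuting operators
(pair versus rest, then forward versus backward steps, then `ν`- versus `μ`-steps) gives the MASTER FORMULA
(`rwLaw_pairRates_apply`): at every `z` with `z ν = 0`,
`p_N(z) = Σ_{i+i'=N} Σ_{P+Q=i} C(N,i) C(i,P) (ρ/2)^i · (REST^{i'} δ₀)(z + (P-Q)e_μ) · T_{P,Q}(γ)`,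
with `T_{P,Q}(γ) = P(Bin(P,γ) = Bin(Q,γ))` (`BinCoincidence.binCoincidence`) and all other factors non-negative and
independent of `γ`.  (iii) Hence (`rwLaw_pairRates_antitoneOn`) `γ ↦ p_N(z)` is non-increasing on `[0, 1/2]` whenever
`z ν = 0`, by `binomialCoincidence_antitoneOn`.  This is the "T-transform" step of DMONO-ALLX §4; the chain of `d` such
steps from rates `(1/d,…,1/d,0)` to `(1/(d+1),…,1/(d+1))` is carried out in `SrwLawDimMonotoneAllX`.
Everything is proved from Mathlib; nothing is a cited fact.

[folklore]
-/

noncomputable section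

open Finset Set

namespace Literature.Probability.FitznerVanDerHofstad2017

namespace RateWalk

open BinCoincidence
open Literature.Barriers.CriticalPhenomena

variable {D : ℕ}

/-- Real-valued functions on `ℤ^D`. [folklore] -/
abbrev LatFun (D : ℕ) : Type := (Fin D → ℤ) → ℝ

/-! ### Translation operators -/

/-- Translation by `v`: `(T_v f)(y) = f (y + v)`, as an `ℝ`-linear operator on `LatFun D`. [folklore] -/
def transl (v : Fin D → ℤ) : Module.End ℝ (LatFun D) :=
  LinearMap.funLeft ℝ ℝ fun y : Fin D → ℤ => y + v

/-- `(T_v f)(y) = f(y+v)`. [folklore] -/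
@[simp] theorem transl_apply (v : Fin D → ℤ) (f : LatFun D) (y : Fin D → ℤ) :
    transl v f y = f (y + v) := rfl

/-- `T_u T_v = T_{u+v}`. [folklore] -/
theorem transl_mul (u v : Fin D → ℤ) : transl u * transl v = transl (u + v) := by
  apply LinearMap.ext
  intro f
  funext y
  simp [Module.End.mul_apply, add_assoc]

/-- Translations commute. [folklore] -/
theorem transl_comm (u v : Fin D → ℤ) : Commute (transl u) (transl v) := by
  change transl u * transl v = transl v * transl u
  rw [transl_mul, transl_mul, add_comm]

/-- `(T_v)^k f (y) = f (y + k v)`. [folklore] -/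
theorem transl_pow_apply (v : Fin D → ℤ) (k : ℕ) (f : LatFun D) (y : Fin D → ℤ) :
    (transl v ^ k) f y = f (y + (k : ℤ) • v) := by
  induction k generalizing y with
  | zero => simp
  | succ k ih =>
    rw [pow_succ', Module.End.mul_apply, transl_apply, ih]
    congr 1
    push_cast
    module

/-! ### Step operators, generator and the law of the rate walk -/

/-- The step operator of coordinate `j`: `K_j = (T_{e_j} + T_{-e_j})/2`. [folklore] -/
def stepOp (j : Fin D) : Module.End ℝ (LatFun D) :=
  (1 / 2 : ℝ) • (transl (Pi.single j 1) + transl (-Pi.single j 1))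

/-- `(K_j f)(y) = (f(y+e_j) + f(y-e_j))/2`. [folklore] -/
theorem stepOp_apply (j : Fin D) (f : LatFun D) (y : Fin D → ℤ) :
    stepOp j f y = (f (y + Pi.single j 1) + f (y - Pi.single j 1)) / 2 := by
  simp only [stepOp, LinearMap.smul_apply, LinearMap.add_apply, Pi.smul_apply, Pi.add_apply,
    transl_apply, smul_eq_mul, sub_eq_add_neg]
  ring

/-- Step operators commute. [folklore] -/
theorem stepOp_comm (i j : Fin D) : Commute (stepOp i) (stepOp j) := by
  unfold stepOp
  exact ((((transl_comm _ _).add_right (transl_comm _ _)).add_left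
    ((transl_comm _ _).add_right (transl_comm _ _))).smul_right _).smul_left _

/-- The generator `A_r = Σ_j r_j K_j` of the walk with coordinate rates `r`. [folklore] -/
def genOp (r : Fin D → ℝ) : Module.End ℝ (LatFun D) := ∑ j, r j • stepOp j

/-- `(A_r f)(y) = Σ_j r_j (f(y+e_j) + f(y-e_j))/2`. [folklore] -/
theorem genOp_apply (r : Fin D → ℝ) (f : LatFun D) (y : Fin D → ℤ) :
    genOp r f y = ∑ j, r j * ((f (y + Pi.single j 1) + f (y - Pi.single j 1)) / 2) := by
  simp only [genOp, LinearMap.sum_apply, Finset.sum_apply, LinearMap.smul_apply, Pi.smul_apply,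
    smul_eq_mul, stepOp_apply]

/-- The point mass at the origin. [folklore] -/
def delta0 : LatFun D := fun y => if y = 0 then 1 else 0

/-- The `n`-step law of the walk with coordinate rates `r` started at `0`: `p^r_n = (A_r)^n δ₀`. [folklore] -/
def rwLaw (r : Fin D → ℝ) (n : ℕ) : LatFun D := (genOp r ^ n) delta0

/-- `p^r_0 = δ₀`. [folklore] -/
theorem rwLaw_zero_apply (r : Fin D → ℝ) (y : Fin D → ℤ) :
    rwLaw r 0 y = if y = 0 then 1 else 0 := by
  simp [rwLaw, delta0]

/-- The one-step recursion `p^r_{n+1}(y) = Σ_j (r_j/2)(p^r_n(y+e_j) + p^r_n(y-e_j))`. [folklore] -/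
theorem rwLaw_succ_apply (r : Fin D → ℝ) (n : ℕ) (y : Fin D → ℤ) :
    rwLaw r (n + 1) y =
      ∑ j, r j * ((rwLaw r n (y + Pi.single j 1) + rwLaw r n (y - Pi.single j 1)) / 2) := by
  rw [rwLaw, pow_succ', Module.End.mul_apply, genOp_apply]
  rfl

/-- With all rates `1/D` the rate walk is simple random walk: `rwLaw (1/D,…,1/D) n = p_n^{(D)}`
(`LongRangePhi4.srwLaw`). [folklore] -/
theorem rwLaw_uniform (D n : ℕ) (y : Fin D → ℤ) :
    rwLaw (fun _ : Fin D => (1 / D : ℝ)) n y = LongRangePhi4.srwLaw D n y := by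
  induction n generalizing y with
  | zero => rw [rwLaw_zero_apply, LongRangePhi4.srwLaw_zero_apply]
  | succ n ih =>
    rw [rwLaw_succ_apply, LongRangePhi4.srwLaw_succ_apply, Finset.sum_div]
    refine Finset.sum_congr rfl fun j _ => ?_
    rw [ih, ih]
    ring

/-! ### Support in a hyperplane and non-negativity -/

/-- `f` vanishes off the hyperplane `{z | z ν = 0}`. [folklore] -/
def VanishOff (ν : Fin D) (f : LatFun D) : Prop := ∀ z, z ν ≠ 0 → f z = 0

/-- `δ₀` vanishes off every coordinate hyperplane. [folklore] -/
theorem vanishOff_delta0 (ν : Fin D) : VanishOff ν (delta0 : LatFun D) := by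
  intro z hz
  unfold delta0
  rw [if_neg]
  intro h
  exact hz (by simp [h])

/-- `K_j` (`j ≠ ν`) preserves vanishing off `{z_ν = 0}`. [folklore] -/
theorem vanishOff_stepOp {ν j : Fin D} (hj : j ≠ ν) {f : LatFun D} (hf : VanishOff ν f) :
    VanishOff ν (stepOp j f) := by
  intro z hz
  have h1 : (z + Pi.single j 1 : Fin D → ℤ) ν ≠ 0 := by simpa [Pi.single_eq_of_ne hj.symm] using hz
  have h2 : (z - Pi.single j 1 : Fin D → ℤ) ν ≠ 0 := by simpa [Pi.single_eq_of_ne hj.symm] using hz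
  rw [stepOp_apply, hf _ h1, hf _ h2]
  simp

/-- The "rest" generator `Σ_{j ∉ {μ,ν}} rest_j K_j`. [folklore] -/
def restOp (rest : Fin D → ℝ) (μ ν : Fin D) : Module.End ℝ (LatFun D) :=
  ∑ j ∈ (univ.erase μ).erase ν, rest j • stepOp j

/-- Pointwise form of the rest generator. [folklore] -/
theorem restOp_apply (rest : Fin D → ℝ) (μ ν : Fin D) (f : LatFun D) (y : Fin D → ℤ) :
    restOp rest μ ν f y = ∑ j ∈ (univ.erase μ).erase ν, rest j * stepOp j f y := by
  simp only [restOp, LinearMap.sum_apply, Finset.sum_apply, LinearMap.smul_apply, Pi.smul_apply,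
    smul_eq_mul]

/-- The rest generator preserves vanishing off `{z_ν = 0}`. [folklore] -/
theorem vanishOff_restOp (rest : Fin D → ℝ) (μ ν : Fin D) {f : LatFun D} (hf : VanishOff ν f) :
    VanishOff ν (restOp rest μ ν f) := by
  intro z hz
  rw [restOp_apply]
  refine Finset.sum_eq_zero fun j hj => ?_
  have hjν : j ≠ ν := (Finset.mem_erase.1 hj).1
  rw [vanishOff_stepOp hjν hf z hz, mul_zero]

/-- `REST^m δ₀` vanishes off `{z_ν = 0}`. [folklore] -/
theorem vanishOff_restOp_pow (rest : Fin D → ℝ) (μ ν : Fin D) (m : ℕ) :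
    VanishOff ν ((restOp rest μ ν ^ m) delta0) := by
  induction m with
  | zero => simpa using vanishOff_delta0 ν
  | succ m ih =>
    rw [pow_succ', Module.End.mul_apply]
    exact vanishOff_restOp _ _ _ ih

/-- `K_j` preserves non-negativity. [folklore] -/
theorem stepOp_nonneg {f : LatFun D} (hf : ∀ z, 0 ≤ f z) (j : Fin D) (z : Fin D → ℤ) :
    0 ≤ stepOp j f z := by
  rw [stepOp_apply]
  exact div_nonneg (add_nonneg (hf _) (hf _)) (by norm_num)

/-- The rest generator (non-negative rates) preserves non-negativity. [folklore] -/
theorem restOp_nonneg {rest : Fin D → ℝ} (hrest : ∀ j, 0 ≤ rest j) (μ ν : Fin D) {f : LatFun D}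
    (hf : ∀ z, 0 ≤ f z) (z : Fin D → ℤ) : 0 ≤ restOp rest μ ν f z := by
  rw [restOp_apply]
  exact Finset.sum_nonneg fun j _ => mul_nonneg (hrest j) (stepOp_nonneg hf j z)

/-- `REST^m δ₀ ≥ 0` for non-negative rates. [folklore] -/
theorem restOp_pow_nonneg {rest : Fin D → ℝ} (hrest : ∀ j, 0 ≤ rest j) (μ ν : Fin D) (m : ℕ)
    (z : Fin D → ℤ) : 0 ≤ (restOp rest μ ν ^ m) delta0 z := by
  induction m generalizing z with
  | zero =>
    simp only [pow_zero, Module.End.one_apply, delta0]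
    split_ifs <;> norm_num
  | succ m ih =>
    rw [pow_succ', Module.End.mul_apply]
    exact restOp_nonneg hrest μ ν ih z

/-! ### The binomial theorem for commuting operators, evaluated -/

/-- `((A+B)^n g)(z) = Σ_{i+i'=n} C(n,i) (A^i (B^{i'} g))(z)` for commuting `A, B`. [folklore] -/
theorem binom_apply {A B : Module.End ℝ (LatFun D)} (h : Commute A B) (n : ℕ) (g : LatFun D)
    (z : Fin D → ℤ) :
    ((A + B) ^ n) g z =
      ∑ m ∈ antidiagonal n, (n.choose m.1 : ℝ) * (A ^ m.1) ((B ^ m.2) g) z := by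
  rw [h.add_pow', LinearMap.sum_apply, Finset.sum_apply]
  refine Finset.sum_congr rfl fun m _ => ?_
  rw [nsmul_eq_mul, Module.End.mul_apply, Module.End.natCast_apply, Module.End.mul_apply,
    Pi.smul_apply, nsmul_eq_mul]

/-- `((a T_u + b T_v)^P g)(z) = Σ_{i+i'=P} C(P,i) a^i b^{i'} g(z + i u + i' v)`. [folklore] -/
theorem smul_transl_binom_apply (a b : ℝ) (u v : Fin D → ℤ) (P : ℕ) (g : LatFun D)
    (z : Fin D → ℤ) :
    ((a • transl u + b • transl v) ^ P) g z =
      ∑ m ∈ antidiagonal P, (P.choose m.1 : ℝ) * (a ^ m.1 * b ^ m.2) *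
        g (z + (m.1 : ℤ) • u + (m.2 : ℤ) • v) := by
  rw [binom_apply (((transl_comm u v).smul_right b).smul_left a)]
  refine Finset.sum_congr rfl fun m _ => ?_
  simp only [smul_pow, LinearMap.smul_apply, Pi.smul_apply, smul_eq_mul, transl_pow_apply]
  ring

/-! ### The pair operators -/

/-- Forward pair operator `U = ργ T_{e_ν} + ρ(1-γ) T_{e_μ}`. [folklore] -/
def Uop (μ ν : Fin D) (ρ γ : ℝ) : Module.End ℝ (LatFun D) :=
  (ρ * γ) • transl (Pi.single ν 1) + (ρ * (1 - γ)) • transl (Pi.single μ 1)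

/-- Backward pair operator `V = ργ T_{-e_ν} + ρ(1-γ) T_{-e_μ}`. [folklore] -/
def Vop (μ ν : Fin D) (ρ γ : ℝ) : Module.End ℝ (LatFun D) :=
  (ρ * γ) • transl (-Pi.single ν 1) + (ρ * (1 - γ)) • transl (-Pi.single μ 1)

/-- `U` and `V` commute. [folklore] -/
theorem Uop_Vop_comm (μ ν : Fin D) (ρ γ : ℝ) : Commute (Uop μ ν ρ γ) (Vop μ ν ρ γ) := by
  unfold Uop Vop
  exact (((transl_comm _ _).smul_right _).add_right ((transl_comm _ _).smul_right _)).smul_left _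
    |>.add_left ((((transl_comm _ _).smul_right _).add_right ((transl_comm _ _).smul_right _)).smul_left _)

/-- `ρ(1-γ) K_μ + ργ K_ν = (U + V)/2`. [folklore] -/
theorem pairOp_eq (μ ν : Fin D) (ρ γ : ℝ) :
    (ρ * (1 - γ)) • stepOp μ + (ρ * γ) • stepOp ν =
      (1 / 2 : ℝ) • (Uop μ ν ρ γ + Vop μ ν ρ γ) := by
  apply LinearMap.ext
  intro f
  funext z
  simp only [Uop, Vop, stepOp_apply, LinearMap.smul_apply, LinearMap.add_apply, Pi.smul_apply,
    Pi.add_apply, smul_eq_mul, transl_apply, sub_eq_add_neg]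
  ring

/-- Binomial weights from the pair rates: `C(P,i) (ργ)^i (ρ(1-γ))^{P-i} = ρ^P · w P i γ`
(for `i ≤ P`; both sides vanish otherwise). [folklore] -/
theorem choose_mul_rates_pow (ρ γ : ℝ) (P i : ℕ) :
    (P.choose i : ℝ) * ((ρ * γ) ^ i * (ρ * (1 - γ)) ^ (P - i)) = ρ ^ P * w P i γ := by
  rcases Nat.lt_or_ge P i with h | h
  · rw [Nat.choose_eq_zero_of_lt h, w_eq_zero_of_lt h]
    simp
  · obtain ⟨k, rfl⟩ := Nat.exists_eq_add_of_le h
    rw [Nat.add_sub_cancel_left]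
    unfold w
    rw [Nat.add_sub_cancel_left, mul_pow, mul_pow, pow_add]
    ring

/-- `T_{P,Q}` only needs the range `j ≤ P`. [folklore] -/
theorem binCoincidence_eq_sum_range_succ (P Q : ℕ) (γ : ℝ) :
    binCoincidence P Q γ = ∑ j ∈ range (P + 1), w P j γ * w Q j γ := by
  unfold binCoincidence
  symm
  refine Finset.sum_subset (fun j hj => ?_) (fun j hj hj' => ?_)
  · simp only [Finset.mem_range] at hj ⊢
    omega
  · simp only [Finset.mem_range, not_lt] at hj hj'
    rw [w_eq_zero_of_lt (by omega), zero_mul]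

/-- **Pair formula.** For `g` vanishing off `{z_ν = 0}` and `z_ν = 0`:
`(U^P (V^Q g))(z) = ρ^{P+Q} · T_{P,Q}(γ) · g(z + (P-Q) e_μ)` — only the forward/backward step patterns with equally
many `ν`-steps in each direction survive, and their weight is the binomial coincidence probability. [folklore] -/
theorem Uop_pow_Vop_pow_apply {μ ν : Fin D} (hμν : μ ≠ ν) (ρ γ : ℝ) (P Q : ℕ) {g : LatFun D}
    (hg : VanishOff ν g) {z : Fin D → ℤ} (hz : z ν = 0) :
    (Uop μ ν ρ γ ^ P) ((Vop μ ν ρ γ ^ Q) g) z =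
      ρ ^ (P + Q) * binCoincidence P Q γ * g (z + ((P : ℤ) - Q) • Pi.single μ 1) := by
  have hνμ : ν ≠ μ := fun h => hμν h.symm
  rw [Uop, smul_transl_binom_apply]
  have inner : ∀ m ∈ antidiagonal P,
      (Vop μ ν ρ γ ^ Q) g (z + (m.1 : ℤ) • Pi.single ν 1 + (m.2 : ℤ) • Pi.single μ 1) =
        (Q.choose m.1 : ℝ) * ((ρ * γ) ^ m.1 * (ρ * (1 - γ)) ^ (Q - m.1)) *
          g (z + ((P : ℤ) - Q) • Pi.single μ 1) := by
    intro m hm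
    have hm' : m.1 + m.2 = P := mem_antidiagonal.1 hm
    rw [Vop, smul_transl_binom_apply]
    rw [Finset.sum_eq_single (m.1, Q - m.1)]
    · -- the surviving term
      by_cases hle : m.1 ≤ Q
      · congr 2
        have h2 : ((m.2 : ℕ) : ℤ) = (P : ℤ) - m.1 := by omega
        have h3 : (((Q - m.1 : ℕ)) : ℤ) = (Q : ℤ) - m.1 := by omega
        simp only [h2, h3]
        module
      · rw [Nat.choose_eq_zero_of_lt (by omega)]
        simp
    · -- all other terms vanish: wrong ν-coordinate
      intro k hk hne
      have hk' : k.1 + k.2 = Q := mem_antidiagonal.1 hk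
      have hk1 : k.1 ≠ m.1 := by
        intro h
        apply hne
        ext
        · exact h
        · simp only
          omega
      rw [hg _ ?_, mul_zero]
      simp only [Pi.add_apply, Pi.smul_apply, Pi.neg_apply, smul_eq_mul, hz,
        Pi.single_eq_same, Pi.single_eq_of_ne hνμ, mul_one, mul_zero, neg_zero, add_zero, zero_add]
      omega
    · -- the designated index outside the antidiagonal: coefficient vanishes
      intro hnot
      have hlt : Q < m.1 := by
        by_contra h
        exact hnot (mem_antidiagonal.2 (by simp only; omega))
      rw [Nat.choose_eq_zero_of_lt hlt]
      simp
  rw [Finset.sum_congr rfl fun m hm => by rw [inner m hm]]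
  -- collect: each term is ρ^P w P m.1 · ρ^Q w Q m.1 · g(…)
  have hterm : ∀ m ∈ antidiagonal P,
      (P.choose m.1 : ℝ) * ((ρ * γ) ^ m.1 * (ρ * (1 - γ)) ^ m.2) *
          ((Q.choose m.1 : ℝ) * ((ρ * γ) ^ m.1 * (ρ * (1 - γ)) ^ (Q - m.1)) *
            g (z + ((P : ℤ) - Q) • Pi.single μ 1)) =
        ρ ^ (P + Q) * g (z + ((P : ℤ) - Q) • Pi.single μ 1) * (w P m.1 γ * w Q m.1 γ) := by
    intro m hm
    have hm' : m.1 + m.2 = P := mem_antidiagonal.1 hm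
    have e1 : (P.choose m.1 : ℝ) * ((ρ * γ) ^ m.1 * (ρ * (1 - γ)) ^ m.2) = ρ ^ P * w P m.1 γ := by
      rw [show m.2 = P - m.1 by omega]
      exact choose_mul_rates_pow ρ γ P m.1
    rw [e1, choose_mul_rates_pow ρ γ Q m.1, pow_add]
    ring
  rw [Finset.sum_congr rfl hterm, ← Finset.mul_sum,
    Finset.Nat.sum_antidiagonal_eq_sum_range_succ_mk (fun m : ℕ × ℕ => w P m.1 γ * w Q m.1 γ),
    ← binCoincidence_eq_sum_range_succ]
  ring

/-! ### Pair rates and the master formula -/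

/-- Rates `ρ(1-γ)` on `μ`, `ργ` on `ν`, and `rest j` on every other coordinate. [folklore] -/
def pairRates (rest : Fin D → ℝ) (μ ν : Fin D) (ρ γ : ℝ) : Fin D → ℝ :=
  fun j => if j = ν then ρ * γ else if j = μ then ρ * (1 - γ) else rest j

/-- Pair-versus-rest decomposition of the generator: `A = (ρ(1-γ) K_μ + ργ K_ν) + REST`. [folklore] -/
theorem genOp_pairRates {μ ν : Fin D} (hμν : μ ≠ ν) (rest : Fin D → ℝ) (ρ γ : ℝ) :
    genOp (pairRates rest μ ν ρ γ) =
      ((ρ * (1 - γ)) • stepOp μ + (ρ * γ) • stepOp ν) + restOp rest μ ν := by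
  have hν : ν ∈ (univ : Finset (Fin D)).erase μ := Finset.mem_erase.2 ⟨fun h => hμν h.symm, mem_univ ν⟩
  unfold genOp restOp
  rw [← Finset.add_sum_erase _ _ (mem_univ μ), ← Finset.add_sum_erase _ _ hν, ← add_assoc]
  simp only [pairRates, if_neg hμν, if_true]
  congr 1
  refine Finset.sum_congr rfl fun j hj => ?_
  obtain ⟨hjν, hj'⟩ := Finset.mem_erase.1 hj
  obtain ⟨hjμ, _⟩ := Finset.mem_erase.1 hj'
  rw [if_neg hjν, if_neg hjμ]

/-- The pair part and the rest part of the generator commute. [folklore] -/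
theorem pair_rest_comm (μ ν : Fin D) (rest : Fin D → ℝ) (ρ γ : ℝ) :
    Commute ((ρ * (1 - γ)) • stepOp μ + (ρ * γ) • stepOp ν) (restOp rest μ ν) := by
  unfold restOp
  refine Commute.add_left ?_ ?_
  · exact (Commute.sum_right _ _ _ fun j _ => (stepOp_comm μ j).smul_right _).smul_left _
  · exact (Commute.sum_right _ _ _ fun j _ => (stepOp_comm ν j).smul_right _).smul_left _

/-- **Master formula.** For `z_ν = 0`,
`p_N(z) = Σ_{i+i'=N} Σ_{P+Q=i} [C(N,i) C(i,P) (ρ/2)^i (REST^{i'} δ₀)(z + (P-Q)e_μ)] · T_{P,Q}(γ)`. [folklore] -/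
theorem rwLaw_pairRates_apply {μ ν : Fin D} (hμν : μ ≠ ν) (rest : Fin D → ℝ) (ρ γ : ℝ) (N : ℕ)
    {z : Fin D → ℤ} (hz : z ν = 0) :
    rwLaw (pairRates rest μ ν ρ γ) N z =
      ∑ m ∈ antidiagonal N, ∑ p ∈ antidiagonal m.1,
        ((N.choose m.1 : ℝ) * (m.1.choose p.1 : ℝ) * (ρ / 2) ^ m.1 *
            (restOp rest μ ν ^ m.2) delta0 (z + ((p.1 : ℤ) - p.2) • Pi.single μ 1)) *
          binCoincidence p.1 p.2 γ := by
  rw [rwLaw, genOp_pairRates hμν, binom_apply (pair_rest_comm μ ν rest ρ γ)]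
  refine Finset.sum_congr rfl fun m _ => ?_
  rw [pairOp_eq, smul_pow, LinearMap.smul_apply, Pi.smul_apply, smul_eq_mul,
    binom_apply (Uop_Vop_comm μ ν ρ γ), Finset.mul_sum, Finset.mul_sum]
  refine Finset.sum_congr rfl fun p hp => ?_
  have hp' : p.1 + p.2 = m.1 := mem_antidiagonal.1 hp
  rw [Uop_pow_Vop_pow_apply hμν ρ γ p.1 p.2 (vanishOff_restOp_pow rest μ ν m.2) hz, hp',
    show (ρ / 2) ^ m.1 = (1 / 2 : ℝ) ^ m.1 * ρ ^ m.1 by rw [div_eq_mul_one_div, mul_pow, mul_comm]]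
  ring

/-- **Monotonicity under a rate transfer inside a pair.**  With the total rate `ρ ≥ 0` of the pair `{μ, ν}` and the
(non-negative) rates of all other coordinates fixed, the probability that the walk is at time `N` at a site `z` with
`z_ν = 0` is non-increasing in the share `γ ∈ [0, 1/2]` of the pair's rate carried by `ν`.  (DMONO-ALLX §4: the
"T-transform"; the planar core is `binomialCoincidence_antitoneOn`.) [folklore] -/
theorem rwLaw_pairRates_antitoneOn {μ ν : Fin D} (hμν : μ ≠ ν) {rest : Fin D → ℝ}
    (hrest : ∀ j, 0 ≤ rest j) {ρ : ℝ} (hρ : 0 ≤ ρ) (N : ℕ) {z : Fin D → ℤ} (hz : z ν = 0) :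
    AntitoneOn (fun γ => rwLaw (pairRates rest μ ν ρ γ) N z) (Icc (0 : ℝ) (1 / 2)) := by
  intro γ₁ h₁ γ₂ h₂ h12
  simp only [rwLaw_pairRates_apply hμν rest ρ _ N hz]
  refine Finset.sum_le_sum fun m _ => Finset.sum_le_sum fun p _ => ?_
  refine mul_le_mul_of_nonneg_left (binCoincidence_antitoneOn p.1 p.2 h₁ h₂ h12) ?_
  have := restOp_pow_nonneg hrest μ ν m.2 (z + ((p.1 : ℤ) - p.2) • Pi.single μ 1)
  positivity

end RateWalk

end Literature.Probability.FitznerVanDerHofstad2017
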